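import Literature.AlgebraicGeometry.Motives.HodgeRiemannBilinearDischarge
import Literature.AlgebraicGeometry.Motives.HodgeDecompositionHardLefschetzDischarge
import Literature.AlgebraicGeometry.Motives.HodgeDecompositionHarmonicRepresentativeProofs
import Literature.AlgebraicGeometry.HodgeTheory.CupPreservesHodgeTypeOfDeRham
import Literature.NumberTheory.Transcendental.KaehlerIdentityLaplacianCorollaries
import Literature.AlgebraicGeometry.Motives.KaehlerTopologyOmegaPowProofs
import Literature.NumberTheory.Transcendental.ComplexFormsHighType
import Literature.Geometry.Kaehler.MatrixFormAlgebra
import HarnessLib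

/-!
# The Hodge–Riemann bilinear relation on primitive cohomology classes (Voisin I, Thm. 6.32)

Theorems-only file (no definitions, no named facts; D-0026), brick B5 of the programme proving
`Literature.AlgebraicGeometry.HodgeTheory.smoothProjective_hodgeStructure_isPolarizable`
(Voisin I, §7.1.2: the Hodge structure on `Hᵏ(X, ℚ)` of a smooth projective variety is
polarised by the hyperplane class).

The harmonic-form version of the Hodge–Riemann bilinear relations is the tree's theorem
`Literature.AlgebraicGeometry.Motives.hodge_riemann_bilinear_holds` (hodge.S15; Huybrechts (2005),
Prop. 3.3.15; Voisin (2002), Thm. 6.32): for a non-zero `∂̄`-harmonic `(p,q)`-form `α`,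
`p + q = k`, `k + r = dim_ℂ`, which is *pointwise primitive* (`α ∧ ω^{r+1} = 0`),
`i^{p-q} (-1)^{k(k-1)/2} ∫ α ∧ ᾱ ∧ ωʳ > 0`. This file performs the printed passage to COHOMOLOGY
CLASSES (Voisin (2002), proof of Thm. 6.32 with Lemma 6.28 and §6.1.3; Huybrechts (2005), proof of
Prop. 3.3.15, p. 163: "any primitive class can be represented by a harmonic form which is
primitive at every point"):

* §Forms — `ωʲ ∧ ·` preserves `Δ_d`-harmonic complex forms (`isCHarmonicForm_wedge_kaehlerForm_ofReal`,
  `isCHarmonicForm_wedge_kaehlerFormPow_ofReal`, from the tree's Lemma 6.28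
  `isCHarmonicForm_lform`), a `Δ_d`-harmonic closed form with zero class vanishes
  (`eq_zero_of_isCHarmonicForm_of_mk_eq_zero`, uniqueness of harmonic representatives, Warner
  Thm. 6.11 = `existsUnique_isHarmonicForm_mk_eq_of_compact_of_isKaehler`), whence **the
  `∂̄`-harmonic representative of a class killed by `L^{j}` satisfies `α ∧ ωʲ = 0` as a form**
  (`wedge_kaehlerFormPow_ofReal_eq_zero_of_mk_eq_zero`).
* §Classes — under a multiplicative real de Rham comparison `e` (Warner Thm. 5.45), the Lefschetz
  iterates of the singular class `κ = e[ω] ⊗ 1` are the classes of `α ∧ ωʲ`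
  (`lefschetzPow_complexifyFun_mk`), and **the Hodge–Riemann relation for primitive `(p,q)`-classes**
  (`hodgeRiemann_primitiveClass`): for `c ∈ H^{p,q}`, `u = (e ⊗ ℂ) c ≠ 0` with `L^{r+1} u = 0`,
  `k + r = d`, the class `i^{p-q} (-1)^{k(k-1)/2} (Lʳ u ∪ ū)` is a POSITIVE real multiple of the
  fundamental class `e[ω^d] ⊗ 1` of `H^{2d}(M; ℂ)` (assumed one-dimensional, as it is for the
  carrier of a Hodge model of a connected smooth projective variety).

## References

* [VoisinHodgeI2002] C. Voisin, Hodge Theory and Complex Algebraic Geometry I (2002), §6.1.3,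
  §6.2.3 Lemma 6.28, §6.3.2 Thm. 6.32, §7.1.2.
* [Huybrechts2005] D. Huybrechts, Complex Geometry (2005), Prop. 3.3.13, Prop. 3.3.15 (p. 163).
* [WarnerGTM94] F. Warner, Foundations of Differentiable Manifolds and Lie Groups, Thm. 5.45,
  Thm. 6.11.
-/

noncomputable section

open scoped Manifold ContDiff Topology ComplexConjugate RealInnerProductSpace
open Bundle Module Set Literature.Geometry.Kaehler Literature.NumberTheory.Transcendental
open Literature.AlgebraicTopology.SingularHomology Literature.AlgebraicGeometry.Motives

namespace Literature.AlgebraicGeometry.HodgeTheory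

/-! ### Forms: `ωʲ ∧ ·` on harmonic forms; primitive harmonic representatives -/

section Forms

variable {E : Type*} [NormedAddCommGroup E] [NormedSpace ℂ E] [FiniteDimensional ℂ E]
  {M : Type*} [TopologicalSpace M] [ChartedSpace E M] [IsManifold 𝓘(ℝ, E) ∞ M]
  [IsManifold 𝓘(ℂ, E) ω M] [T2Space M] [CompactSpace M]
  {n : ℕ} [Fact (finrank ℝ E = n)]
  (g : ContMDiffRiemannianMetric 𝓘(ℝ, E) ∞ E (fun x : M ↦ TangentSpace 𝓘(ℝ, E) x))
  (o : (x : M) → Orientation ℝ (TangentSpace 𝓘(ℝ, E) x) (Fin n))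

omit [FiniteDimensional ℂ E] [IsManifold 𝓘(ℝ, E) ∞ M] [IsManifold 𝓘(ℂ, E) ω M] [T2Space M]
  [CompactSpace M] [Fact (finrank ℝ E = n)] in
/-- The constant `0`-form `1 ⊗ 1` is a right unit for the wedge of complex forms
(`wedge_constOfIsEmpty` pointwise; Warner (1983), 2.6). [cite: WarnerGTM94, 2.6] -/
theorem wedge_const_one_ofReal {k : ℕ} (γ : MForm 𝓘(ℝ, E) M ℂ k) :
    γ.wedge (MForm.const 𝓘(ℝ, E) M (1 : ℝ)).ofReal = γ := by
  funext x
  have h1 : (MForm.const 𝓘(ℝ, E) M (1 : ℝ)).ofReal x =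
      ContinuousAlternatingMap.constOfIsEmpty ℝ E (Fin 0) (1 : ℂ) := by
    ext v
    simp only [MForm.ofReal_apply, MForm.const_apply]
    rfl
  rw [MForm.wedge_apply, h1,
    ContinuousAlternatingMap.WedgeComm_holds ℝ E ℂ (ContinuousAlternatingMap.constOfIsEmpty ℝ E
      (Fin 0) (1 : ℂ)) (show E [⋀^Fin k]→L[ℝ] ℂ from γ x),
    ContinuousAlternatingMap.constOfIsEmpty_one_wedge, zero_mul, pow_zero, one_smul]
  ext v
  simp only [ContinuousAlternatingMap.domDomCongr_apply]
  exact congrArg (show E [⋀^Fin k]→L[ℝ] ℂ from γ x) (funext fun i ↦ congrArg v (Fin.ext rfl))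

omit [FiniteDimensional ℂ E] [IsManifold 𝓘(ℝ, E) ∞ M] [IsManifold 𝓘(ℂ, E) ω M] [T2Space M]
  [CompactSpace M] [Fact (finrank ℝ E = n)] in
/-- `γ ∧ (ω⁰ ⊗ 1) = γ` up to the degree cast `k = k + 2·0` (`ω⁰ = 1`). [folklore] -/
theorem wedge_kaehlerFormPow_zero_ofReal (g' : RiemannianMetric (fun x : M ↦ TangentSpace 𝓘(ℝ, E) x))
    {k : ℕ} (γ : MForm 𝓘(ℝ, E) M ℂ k) :
    γ.wedge (kaehlerFormPow g' 0).ofReal = γ.castDeg (by omega) := by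
  rw [kaehlerFormPow_zero, MForm.ofReal_castDeg, MForm.wedge_castDeg, wedge_const_one_ofReal]

omit [FiniteDimensional ℂ E] [IsManifold 𝓘(ℝ, E) ∞ M] [IsManifold 𝓘(ℂ, E) ω M] [T2Space M]
  [CompactSpace M] [Fact (finrank ℝ E = n)] in
/-- **`γ ∧ ω^{j+1} = ω ∧ (γ ∧ ωʲ)`** for complex forms (`ω^{j+1} = ωʲ ∧ ω`, associativity and graded
commutativity of `∧`, `ω` of even degree), with the degree cast `2 + (k + 2j) = k + 2(j+1)` of the
Lefschetz iterate `L^{j+1} = L ∘ Lʲ`. [cite: VoisinHodgeI2002, §6.2.3] -/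
theorem wedge_kaehlerFormPow_succ_ofReal [WedgeFacts 𝓘(ℝ, E) M ℂ]
    (g' : RiemannianMetric (fun x : M ↦ TangentSpace 𝓘(ℝ, E) x)) {k : ℕ} (γ : MForm 𝓘(ℝ, E) M ℂ k)
    (j : ℕ) (e : 2 + (k + 2 * j) = k + 2 * (j + 1)) :
    γ.wedge (kaehlerFormPow g' (j + 1)).ofReal =
      (g'.kaehlerForm.ofReal.wedge (γ.wedge (kaehlerFormPow g' j).ofReal)).castDeg e := by
  rw [kaehlerFormPow_succ, MForm.ofReal_castDeg, MForm.wedge_castDeg, MForm.ofReal_wedge]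
  have hassoc := MForm.wedge_assoc γ (kaehlerFormPow g' j).ofReal g'.kaehlerForm.ofReal
  -- `γ ∧ (ωʲ ∧ ω) = ((γ ∧ ωʲ) ∧ ω).cast`
  have h1 : γ.wedge ((kaehlerFormPow g' j).ofReal.wedge g'.kaehlerForm.ofReal) =
      ((γ.wedge (kaehlerFormPow g' j).ofReal).wedge g'.kaehlerForm.ofReal).castDeg
        (Nat.add_assoc k (2 * j) 2) := by
    rw [hassoc, MForm.castDeg_castDeg, MForm.castDeg_rfl]
  rw [h1, MForm.wedge_comm g'.kaehlerForm.ofReal (γ.wedge (kaehlerFormPow g' j).ofReal),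
    MForm.castDeg_smul, MForm.castDeg_smul, MForm.castDeg_castDeg, MForm.castDeg_castDeg, pow_mul,
    neg_one_sq, one_pow, one_smul]

omit [IsManifold 𝓘(ℝ, E) ∞ M] [IsManifold 𝓘(ℂ, E) ω M] [T2Space M] [CompactSpace M] in
/-- Harmonicity is insensitive to a degree cast. [folklore] -/
theorem isCHarmonicForm_castDeg_iff [RiemannianBundle (fun x : M ↦ TangentSpace 𝓘(ℝ, E) x)]
    {k k' m : ℕ} (e : k = k') (h : k + m = n) (h' : k' + m = n) (α : MForm 𝓘(ℝ, E) M ℂ k) :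
    IsCHarmonicForm o h' (α.castDeg e) ↔ IsCHarmonicForm o h α := by
  subst e
  rfl

omit [IsManifold 𝓘(ℝ, E) ∞ M] [IsManifold 𝓘(ℂ, E) ω M] [T2Space M] [CompactSpace M] in
/-- Harmonicity does not depend on the name of the complementary degree. [folklore] -/
theorem isCHarmonicForm_congr [RiemannianBundle (fun x : M ↦ TangentSpace 𝓘(ℝ, E) x)]
    {k m m' : ℕ} (h : k + m = n) (h' : k + m' = n) (α : MForm 𝓘(ℝ, E) M ℂ k) :
    IsCHarmonicForm o h α ↔ IsCHarmonicForm o h' α := by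
  obtain rfl : m = m' := by omega
  rfl

/-- **`L = ω ∧ ·` preserves `Δ_d`-harmonic complex forms** (Voisin (2002), Lemma 6.28
`[L, Δ_d] = 0`, in the form used in the proofs of Thm. 6.25 and Thm. 6.32), written with `ω` on the
right: on a compact Kähler `(M, g)`, if `γ` is `Δ_d`-harmonic then so is `γ ∧ (ω ⊗ 1)`. From the
tree's `isCHarmonicForm_lform` / `isCHarmonicForm_lform_zero` (`L γ` harmonic for the
alternatisation-normalised `L`), `L = (ω ⊗ 1) ∧ ·` (`lform_eq_castDeg_kaehlerForm_wedge`) and graded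
commutativity. [cite: VoisinHodgeI2002, §6.2.3 Lemma 6.28] -/
theorem isCHarmonicForm_wedge_kaehlerForm_ofReal (hg : g.toRiemannianMetric.IsKaehler)
    {k m m' : ℕ} (h : k + m = n) (h' : (k + 2) + m' = n) {γ : MForm 𝓘(ℝ, E) M ℂ k} :
    letI : RiemannianBundle (fun x : M ↦ TangentSpace 𝓘(ℝ, E) x) := ⟨g.toRiemannianMetric⟩
    IsSmoothForm (riemannianVolumeForm o) → IsCHarmonicForm o h γ →
      IsCHarmonicForm o h' (γ.wedge g.toRiemannianMetric.kaehlerForm.ofReal) := by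
  intro ho hγ
  letI : RiemannianBundle (fun x : M ↦ TangentSpace 𝓘(ℝ, E) x) := ⟨g.toRiemannianMetric⟩
  haveI : WedgeFacts 𝓘(ℝ, E) M ℂ :=
    wedgeFacts_of_assoc 𝓘(ℝ, E) M ℂ (ContinuousAlternatingMap.WedgeAssoc_holds ℝ E ℂ)
  have hG : ∀ (x : M) (v w : TangentSpace 𝓘(ℝ, E) x), g.inner x v w = ⟪v, w⟫ := fun _ _ _ ↦ rfl
  have hH : ∀ (x : M) (v w : E), g.inner x (Complex.I • v) (Complex.I • w) = g.inner x v w :=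
    fun x v w ↦ hg.1 x v w
  have h₁ : (k + 1 + 1) + m' = n := h'
  have hL : IsCHarmonicForm o h₁
      ((g.toRiemannianMetric.kaehlerForm.ofReal.wedge γ).castDeg (Nat.add_comm 2 k)) := by
    rcases k with - | k
    · exact (congrArg (IsCHarmonicForm o h₁)
        (lform_eq_castDeg_kaehlerForm_wedge g.inner hG hH γ)).mp
        (isCHarmonicForm_lform_zero g o hg h₁ h ho hγ)
    · exact (congrArg (IsCHarmonicForm o h₁)
        (lform_eq_castDeg_kaehlerForm_wedge g.inner hG hH γ)).mp
        (isCHarmonicForm_lform g o hg h₁ h ho hγ)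
  rw [MForm.wedge_comm g.toRiemannianMetric.kaehlerForm.ofReal γ, pow_mul, neg_one_sq, one_pow,
    one_smul]
  exact hL

/-- **`ωʲ ∧ ·` preserves `Δ_d`-harmonic complex forms** (iteration of Lemma 6.28): if `γ` is
`Δ_d`-harmonic of degree `k` and `k + 2j ≤ dim_ℝ M`, then `γ ∧ (ωʲ ⊗ 1)` is `Δ_d`-harmonic.
[cite: VoisinHodgeI2002, §6.2.3 Lemma 6.28] -/
theorem isCHarmonicForm_wedge_kaehlerFormPow_ofReal (hg : g.toRiemannianMetric.IsKaehler)
    {k m : ℕ} (h : k + m = n) {γ : MForm 𝓘(ℝ, E) M ℂ k} :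
    letI : RiemannianBundle (fun x : M ↦ TangentSpace 𝓘(ℝ, E) x) := ⟨g.toRiemannianMetric⟩
    IsSmoothForm (riemannianVolumeForm o) → IsCHarmonicForm o h γ →
      ∀ (j m' : ℕ) (h' : (k + 2 * j) + m' = n),
        IsCHarmonicForm o h' (γ.wedge (kaehlerFormPow g.toRiemannianMetric j).ofReal) := by
  intro ho hγ j
  letI : RiemannianBundle (fun x : M ↦ TangentSpace 𝓘(ℝ, E) x) := ⟨g.toRiemannianMetric⟩
  haveI : WedgeFacts 𝓘(ℝ, E) M ℂ :=
    wedgeFacts_of_assoc 𝓘(ℝ, E) M ℂ (ContinuousAlternatingMap.WedgeAssoc_holds ℝ E ℂ)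
  induction j with
  | zero =>
    intro m' h'
    rw [wedge_kaehlerFormPow_zero_ofReal, isCHarmonicForm_castDeg_iff o _ (by omega : k + m' = n) h']
    exact (isCHarmonicForm_congr o h _ γ).1 hγ
  | succ j ih =>
    intro m' h'
    have hj : (k + 2 * j) + (m' + 2) = n := by omega
    have hprev := ih (m' + 2) hj
    have hstep := isCHarmonicForm_wedge_kaehlerForm_ofReal g o hg hj (m' := m') (by omega) ho hprev
    -- `(γ ∧ ωʲ) ∧ ω = γ ∧ ω^{j+1}` up to the cast
    have hform : (γ.wedge (kaehlerFormPow g.toRiemannianMetric j).ofReal).wedge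
        g.toRiemannianMetric.kaehlerForm.ofReal =
        (γ.wedge (kaehlerFormPow g.toRiemannianMetric (j + 1)).ofReal).castDeg (by omega) := by
      rw [wedge_kaehlerFormPow_succ_ofReal g.toRiemannianMetric γ j (by omega),
        MForm.wedge_comm g.toRiemannianMetric.kaehlerForm.ofReal, pow_mul, neg_one_sq, one_pow,
        one_smul, MForm.castDeg_castDeg]
    rw [hform, isCHarmonicForm_castDeg_iff o _ h'] at hstep
    exact hstep

/-- **A `Δ_d`-harmonic closed complex form with zero de Rham class vanishes** on a compact Kähler
manifold (uniqueness of harmonic representatives, Warner Thm. 6.11, applied to the real and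
imaginary parts: `existsUnique_isHarmonicForm_mk_eq_of_compact_of_isKaehler`,
`isCHarmonicForm_iff_re_im`). [cite: WarnerGTM94, Thm. 6.11] [cite: VoisinHodgeI2002, Thm. 5.23] -/
theorem eq_zero_of_isCHarmonicForm_of_mk_eq_zero (hg : g.toRiemannianMetric.IsKaehler)
    {k m : ℕ} (h : k + m = n) {γ : MForm 𝓘(ℝ, E) M ℂ k} (hγc : γ ∈ cclosedSmoothForms E M k) :
    letI : RiemannianBundle (fun x : M ↦ TangentSpace 𝓘(ℝ, E) x) := ⟨g.toRiemannianMetric⟩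
    IsSmoothForm (riemannianVolumeForm o) → IsCHarmonicForm o h γ →
      complexDeRhamCohomology.mk E M k ⟨γ, hγc⟩ = 0 → γ = 0 := by
  intro ho hγ h0
  letI : RiemannianBundle (fun x : M ↦ TangentSpace 𝓘(ℝ, E) x) := ⟨g.toRiemannianMetric⟩
  haveI : IsContMDiffRiemannianBundle 𝓘(ℝ, E) ∞ E (fun x : M ↦ TangentSpace 𝓘(ℝ, E) x) :=
    ⟨g.inner, g.contMDiff, fun _ _ _ ↦ rfl⟩
  have hri := (isCHarmonicForm_iff_re_im o ho h γ).1 hγ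
  have hEU := existsUnique_isHarmonicForm_mk_eq_of_compact_of_isKaehler g o hg k m ho h 0
  have h2 : IsHarmonicForm o h (0 : ↥(closedSmoothForms 𝓘(ℝ, E) M ℝ k)).1 ∧
      deRhamCohomology.mk (0 : ↥(closedSmoothForms 𝓘(ℝ, E) M ℝ k)) = 0 :=
    ⟨isHarmonicForm_zero o h, map_zero _⟩
  have hre : (⟨γ.re, re_mem_closedSmoothForms hγc⟩ : closedSmoothForms 𝓘(ℝ, E) M ℝ k) = 0 :=
    hEU.unique ⟨hri.1, by rw [← complexDeRhamCohomology.re_mk ⟨γ, hγc⟩, h0, LinearMap.map_zero]⟩ h2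
  have him : (⟨γ.im, im_mem_closedSmoothForms hγc⟩ : closedSmoothForms 𝓘(ℝ, E) M ℝ k) = 0 :=
    hEU.unique ⟨hri.2, by rw [← complexDeRhamCohomology.im_mk ⟨γ, hγc⟩, h0, LinearMap.map_zero]⟩ h2
  refine MForm.ext_re_im ?_ ?_
  · rw [MForm.re_zero]; exact congrArg Subtype.val hre
  · rw [MForm.im_zero]; exact congrArg Subtype.val him

/-- **Primitive classes have pointwise-primitive harmonic representatives** (Huybrechts (2005),
proof of Prop. 3.3.15, p. 163; Voisin (2002), proof of Thm. 6.32 via Lemma 6.28): on a compact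
Kähler manifold, if `α` lies in the span of the `∂̄`-harmonic `(p,q)`-forms, is closed, and the de
Rham class of `α ∧ (ωʲ ⊗ 1)` vanishes (with `deg + 2j ≤ dim_ℝ`), then `α ∧ (ωʲ ⊗ 1) = 0` AS A FORM:
`α` is `Δ_d`-harmonic (`Δ_d = 2Δ_∂̄`, `dolbeaultHarmonicForms_le_charmonicForms_…`), so is
`α ∧ ωʲ` (Lemma 6.28), and a harmonic form with zero class is zero.
[cite: Huybrechts2005, Prop. 3.3.15 (proof)] [cite: VoisinHodgeI2002, Lemma 6.28 and Thm. 6.32] -/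
theorem wedge_kaehlerFormPow_ofReal_eq_zero_of_mk_eq_zero (hg : g.toRiemannianMetric.IsKaehler)
    {p q k m : ℕ} (h : k + m = n) {α : MForm 𝓘(ℝ, E) M ℂ k} {j m' : ℕ} (h' : (k + 2 * j) + m' = n)
    (hc : α.wedge (kaehlerFormPow g.toRiemannianMetric j).ofReal ∈ cclosedSmoothForms E M (k + 2 * j)) :
    letI : RiemannianBundle (fun x : M ↦ TangentSpace 𝓘(ℝ, E) x) := ⟨g.toRiemannianMetric⟩
    IsSmoothForm (riemannianVolumeForm o) → α ∈ dolbeaultHarmonicForms o p q h →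
      complexDeRhamCohomology.mk E M (k + 2 * j)
          ⟨α.wedge (kaehlerFormPow g.toRiemannianMetric j).ofReal, hc⟩ = 0 →
        α.wedge (kaehlerFormPow g.toRiemannianMetric j).ofReal = 0 := by
  intro ho hα h0
  letI : RiemannianBundle (fun x : M ↦ TangentSpace 𝓘(ℝ, E) x) := ⟨g.toRiemannianMetric⟩
  haveI : IsContMDiffRiemannianBundle 𝓘(ℝ, E) ∞ E (fun x : M ↦ TangentSpace 𝓘(ℝ, E) x) :=
    ⟨g.inner, g.contMDiff, fun _ _ _ ↦ rfl⟩
  have hαc : α ∈ charmonicForms o h :=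
    dolbeaultHarmonicForms_le_charmonicForms_of_isManifold_complex_of_t2Space g o hg h p q ho hα
  have hαH : IsCHarmonicForm o h α := (mem_charmonicForms_iff_of_contMDiffMetric o ho h α).1 hαc
  have hH := isCHarmonicForm_wedge_kaehlerFormPow_ofReal g o hg h ho hαH j m' h'
  exact eq_zero_of_isCHarmonicForm_of_mk_eq_zero g o hg h' hc ho hH h0

end Forms

/-! ### Classes: Lefschetz iterates under `e ⊗ ℂ`; the Hodge–Riemann relation for primitive classes -/

section Classes

universe u

variable {E : Type u} [NormedAddCommGroup E] [NormedSpace ℂ E] [FiniteDimensional ℂ E]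
  {M : Type u} [TopologicalSpace M] [ChartedSpace E M] [IsManifold 𝓘(ℝ, E) ∞ M]
  [IsManifold 𝓘(ℂ, E) ω M] [T2Space M] [CompactSpace M]

omit [T2Space M] [CompactSpace M] in
/-- The powers of the Kähler form of a Kähler metric are closed smooth real forms.
[cite: VoisinHodgeI2002, §3.1.2] -/
theorem kaehlerFormPow_mem_closedSmoothForms
    (hω : isSmoothForm_kaehlerForm_of_isManifold_complex (E := E) (M := M))
    (g : ContMDiffRiemannianMetric 𝓘(ℝ, E) ∞ E (fun x : M ↦ TangentSpace 𝓘(ℝ, E) x))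
    (hg : g.toRiemannianMetric.IsKaehler) (j : ℕ) :
    kaehlerFormPow g.toRiemannianMetric j ∈ closedSmoothForms 𝓘(ℝ, E) M ℝ (2 * j) := by
  haveI : WedgeFacts 𝓘(ℝ, E) M ℝ :=
    wedgeFacts_of_assoc 𝓘(ℝ, E) M ℝ (ContinuousAlternatingMap.WedgeAssoc_holds ℝ E ℝ)
  exact (mem_closedSmoothForms_iff _).2
    ⟨isSmoothForm_kaehlerFormPow hω g j, isClosedForm_kaehlerFormPow hω g hg j⟩

omit [FiniteDimensional ℂ E] [IsManifold 𝓘(ℝ, E) ∞ M] [IsManifold 𝓘(ℂ, E) ω M] [T2Space M]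
  [CompactSpace M] in
/-- A degree cast preserves closed smooth complex forms. [folklore] -/
theorem castDeg_mem_cclosedSmoothForms {k k' : ℕ} (h : k = k') {α : MForm 𝓘(ℝ, E) M ℂ k}
    (hα : α ∈ cclosedSmoothForms E M k) : α.castDeg h ∈ cclosedSmoothForms E M k' := by
  subst h
  exact hα

omit [T2Space M] [CompactSpace M] in
/-- `α ∧ (ωʲ ⊗ 1)` is a closed smooth complex form for `α` closed. [folklore] -/
theorem wedge_kaehlerFormPow_ofReal_mem_cclosedSmoothForms [WedgeFacts 𝓘(ℝ, E) M ℂ]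
    (hω : isSmoothForm_kaehlerForm_of_isManifold_complex (E := E) (M := M))
    (g : ContMDiffRiemannianMetric 𝓘(ℝ, E) ∞ E (fun x : M ↦ TangentSpace 𝓘(ℝ, E) x))
    (hg : g.toRiemannianMetric.IsKaehler) {k : ℕ} {α : MForm 𝓘(ℝ, E) M ℂ k}
    (hα : α ∈ cclosedSmoothForms E M k) (j : ℕ) :
    α.wedge (kaehlerFormPow g.toRiemannianMetric j).ofReal ∈ cclosedSmoothForms E M (k + 2 * j) :=
  wedge_mem_cclosedSmoothForms hα
    (ofReal_mem_cclosedSmoothForms (kaehlerFormPow_mem_closedSmoothForms hω g hg j))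

variable (e : DeRhamIsoFamily 𝓘(ℝ, E))

omit [FiniteDimensional ℂ E] [IsManifold 𝓘(ℂ, E) ω M] [CompactSpace M] in
/-- **`(e ⊗ ℂ)[α] ∪ (e ⊗ ℂ)[β] = (e ⊗ ℂ)[α ∧ β]`** with the cup product's free target degree
`k + l = m` (the tree's `complexifyFun_mk_wedge`, Warner Thm. 5.45, recast). [cite: WarnerGTM94, Thm. 5.45] -/
theorem cupProduct_complexifyFun_mk [SigmaCompactSpace M] [WedgeFacts 𝓘(ℝ, E) M ℝ]
    [WedgeFacts 𝓘(ℝ, E) M ℂ] {e} (hem : e.IsMultiplicative) {k l m : ℕ} (h : k + l = m)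
    (α : cclosedSmoothForms E M k) (β : cclosedSmoothForms E M l) :
    cupProduct h (complexifyFun e k (complexDeRhamCohomology.mk E M k α))
        (complexifyFun e l (complexDeRhamCohomology.mk E M l β)) =
      complexifyFun e m (complexDeRhamCohomology.mk E M m
        ⟨((α : MForm 𝓘(ℝ, E) M ℂ k).wedge (β : MForm 𝓘(ℝ, E) M ℂ l)).castDeg h,
          castDeg_mem_cclosedSmoothForms h (wedge_mem_cclosedSmoothForms α.2 β.2)⟩) := by
  subst h
  rw [← complexifyFun_mk_wedge hem α β]
  rfl

/-- **The Lefschetz iterates of `(e ⊗ ℂ)[α]` are the classes of `α ∧ ωʲ`**: for the singular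
Kähler class `κ = e[ω] ⊗ 1 ∈ H²(M; ℂ)` of a multiplicative real de Rham comparison `e` (Warner
Thm. 5.45) and a closed complex `k`-form `α`, `Lʲ_κ ((e ⊗ ℂ)[α]) = (e ⊗ ℂ)[α ∧ (ωʲ ⊗ 1)]`
(`L [β] = [ω ∧ β]`, Voisin I §6.2.3 / Lemma 6.28; `γ ∧ ω^{j+1} = ω ∧ (γ ∧ ωʲ)`).
[cite: VoisinHodgeI2002, §6.2.3] [cite: WarnerGTM94, Thm. 5.45] -/
theorem lefschetzPow_complexifyFun_mk {e} (hem : e.IsMultiplicative)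
    (hω : isSmoothForm_kaehlerForm_of_isManifold_complex (E := E) (M := M))
    (g : ContMDiffRiemannianMetric 𝓘(ℝ, E) ∞ E (fun x : M ↦ TangentSpace 𝓘(ℝ, E) x))
    (hg : g.toRiemannianMetric.IsKaehler) {k : ℕ} (α : cclosedSmoothForms E M k) (j : ℕ) :
    haveI : WedgeFacts 𝓘(ℝ, E) M ℂ :=
      wedgeFacts_of_assoc 𝓘(ℝ, E) M ℂ (ContinuousAlternatingMap.WedgeAssoc_holds ℝ E ℂ)
    lefschetzPow (ofRealClass M 2 (e M 2 (g.kaehlerClass hω hg))) j k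
        (complexifyFun e k (complexDeRhamCohomology.mk E M k α)) =
      complexifyFun e (k + 2 * j) (complexDeRhamCohomology.mk E M (k + 2 * j)
        ⟨(α : MForm 𝓘(ℝ, E) M ℂ k).wedge (kaehlerFormPow g.toRiemannianMetric j).ofReal,
          wedge_kaehlerFormPow_ofReal_mem_cclosedSmoothForms hω g hg α.2 j⟩) := by
  haveI : WedgeFacts 𝓘(ℝ, E) M ℝ :=
    wedgeFacts_of_assoc 𝓘(ℝ, E) M ℝ (ContinuousAlternatingMap.WedgeAssoc_holds ℝ E ℝ)
  haveI : WedgeFacts 𝓘(ℝ, E) M ℂ :=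
    wedgeFacts_of_assoc 𝓘(ℝ, E) M ℂ (ContinuousAlternatingMap.WedgeAssoc_holds ℝ E ℂ)
  -- the singular Kähler class as the `(e ⊗ ℂ)`-image of `[ω ⊗ 1]`
  set ωc : cclosedSmoothForms E M 2 := ⟨g.toRiemannianMetric.kaehlerForm.ofReal,
    ofReal_mem_cclosedSmoothForms ((mem_closedSmoothForms_iff _).2 ⟨hω g, hg.2⟩)⟩ with hωc
  have hκ : ofRealClass M 2 (e M 2 (g.kaehlerClass hω hg)) =
      complexifyFun e 2 (complexDeRhamCohomology.mk E M 2 ωc) := by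
    rw [← complexifyFun_ofReal]
    rfl
  induction j with
  | zero =>
    rw [lefschetzPow_zero, LinearMap.id_apply]
    change complexifyFun e k (complexDeRhamCohomology.mk E M k α) =
      complexifyFun e k (complexDeRhamCohomology.mk E M k _)
    congr 2
    apply Subtype.ext
    change (α : MForm 𝓘(ℝ, E) M ℂ k) =
      (α : MForm 𝓘(ℝ, E) M ℂ k).wedge (kaehlerFormPow g.toRiemannianMetric 0).ofReal
    rw [wedge_kaehlerFormPow_zero_ofReal]
    exact (MForm.castDeg_rfl _).symm
  | succ j ih =>
    rw [lefschetzPow_succ, LinearMap.comp_apply, lefschetzOperator_apply, ih, hκ,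
      cupProduct_complexifyFun_mk hem]
    congr 2
    apply Subtype.ext
    exact (wedge_kaehlerFormPow_succ_ofReal g.toRiemannianMetric (α : MForm 𝓘(ℝ, E) M ℂ k) j _).symm

/-! ### Integration of top-degree complex classes -/

omit [IsManifold 𝓘(ℂ, E) ω M] in
/-- `∫_M z • β = z · ∫_M β` for a smooth complex top form `β` and `z ∈ ℂ` (additivity of `∫_M` on
smooth forms, `MForm.integral_add_holds`, and `MForm.integral_smul`). [cite: WarnerGTM94, 4.8] -/
theorem cintegral_smul {n : ℕ} [Fact (finrank ℝ E = n)] [MeasurableSpace E] [BorelSpace E]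
    (o : (x : M) → Orientation ℝ (TangentSpace 𝓘(ℝ, E) x) (Fin n)) (ho : IsContinuousOrientation o)
    (z : ℂ) {β : MForm 𝓘(ℝ, E) M ℂ n} (hβ : IsSmoothForm β) :
    cintegral o (z • β) = z * cintegral o β := by
  apply Complex.ext
  · rw [re_cintegral, MForm.re_smul, sub_eq_add_neg, ← neg_smul,
      MForm.integral_add_holds (I := 𝓘(ℝ, E)) (M := M) o ho (hβ.re.smul _) (hβ.im.smul _),
      MForm.integral_smul, MForm.integral_smul, Complex.mul_re, re_cintegral, im_cintegral]
    ring
  · rw [im_cintegral, MForm.im_smul,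
      MForm.integral_add_holds (I := 𝓘(ℝ, E)) (M := M) o ho (hβ.im.smul _) (hβ.re.smul _),
      MForm.integral_smul, MForm.integral_smul, Complex.mul_im, re_cintegral, im_cintegral]

omit [IsManifold 𝓘(ℂ, E) ω M] in
/-- **`∫_M` descends to top-degree complex de Rham cohomology**: cohomologous closed smooth complex top
forms have the same integral (their difference is exact, so are its real and imaginary parts, which
integrate to zero by Stokes, `MForm.integral_eq_zero_of_mem_exactSmoothForms_holds`).
[cite: WarnerGTM94, Thm. 4.9] -/
theorem cintegral_eq_of_mk_eq {n : ℕ} [Fact (finrank ℝ E = n)] [MeasurableSpace E] [BorelSpace E]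
    (o : (x : M) → Orientation ℝ (TangentSpace 𝓘(ℝ, E) x) (Fin n)) (ho : IsContinuousOrientation o)
    {β₁ β₂ : MForm 𝓘(ℝ, E) M ℂ n} (h₁ : β₁ ∈ cclosedSmoothForms E M n)
    (h₂ : β₂ ∈ cclosedSmoothForms E M n)
    (h : complexDeRhamCohomology.mk E M n ⟨β₁, h₁⟩ = complexDeRhamCohomology.mk E M n ⟨β₂, h₂⟩) :
    cintegral o β₁ = cintegral o β₂ := by
  have hex := MForm.integral_eq_zero_of_mem_exactSmoothForms_holds (I := 𝓘(ℝ, E)) (M := M) o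
  have hd : β₁ - β₂ ∈ cexactSmoothForms E M n := (complexDeRhamCohomology.mk_eq_mk_iff _ _).1 h
  have hs₁ : IsSmoothForm β₁ := ((mem_cclosedSmoothForms_iff β₁).1 h₁).1
  have hs₂ : IsSmoothForm β₂ := ((mem_cclosedSmoothForms_iff β₂).1 h₂).1
  have hre : MForm.integral o β₁.re = MForm.integral o β₂.re := by
    have h0 := hex ho (re_mem_exactSmoothForms hd)
    rw [MForm.re_sub] at h0
    have := MForm.integral_add_holds (I := 𝓘(ℝ, E)) (M := M) o ho (hs₁.re.sub hs₂.re) hs₂.re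
    rw [sub_add_cancel, h0, zero_add] at this
    exact this
  have him : MForm.integral o β₁.im = MForm.integral o β₂.im := by
    have h0 := hex ho (im_mem_exactSmoothForms hd)
    rw [MForm.im_sub] at h0
    have := MForm.integral_add_holds (I := 𝓘(ℝ, E)) (M := M) o ho (hs₁.im.sub hs₂.im) hs₂.im
    rw [sub_add_cancel, h0, zero_add] at this
    exact this
  apply Complex.ext
  · rw [re_cintegral, re_cintegral, hre]
  · rw [im_cintegral, im_cintegral, him]

/-! ### The Hodge–Riemann bilinear relation on primitive classes -/

/-- **Hodge–Riemann bilinear relation for primitive `(p,q)`-classes** (Voisin (2002), Thm. 6.32;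
Huybrechts (2005), Prop. 3.3.15), in singular cohomology through a multiplicative real de Rham
comparison `e` (Warner Thm. 5.45) with singular Kähler class `κ = e[ω] ⊗ 1`. Let `(M, g)` be a
compact connected Kähler manifold of complex dimension `d` (`finrank ℂ E = d`, a free name for the
dimension so that consumers may instantiate it) whose top cohomology `H^{2d}(M; ℂ)` is a line, `c ∈ H^{p,q} ⊆ Hᵏ_dR(M; ℂ)` a non-zero class with `k + r = d` whose image `u = (e ⊗ ℂ) c` is
PRIMITIVE, `L_κ^{r+1} u = 0`. Then
`i^{p-q} (-1)^{k(k-1)/2} · (L_κ^r u ∪ ū) = t · (e[ω^d] ⊗ 1)` in `H^{2d}(M; ℂ)` for a real `t > 0`.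
Proof (the printed one): represent `c` by its `∂̄`-harmonic `(p,q)`-form `α` (§6.1.3,
`existsUnique_isDolbeaultHarmonic_of_mem_hodgePQ_of`); `L^{r+1} u = (e ⊗ ℂ)[α ∧ ω^{r+1}] = 0`
(`lefschetzPow_complexifyFun_mk`) forces `α ∧ ω^{r+1} = 0` AS A FORM (harmonic, Lemma 6.28, with zero
class; `wedge_kaehlerFormPow_ofReal_eq_zero_of_mk_eq_zero`), so hodge.S15
(`hodge_riemann_bilinear_holds`) gives `i^{p-q}(-1)^{k(k-1)/2} ∫ α ∧ ᾱ ∧ ωʳ > 0`; as `H^{2d}` is a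
line spanned by `[ω^d]` (`∫ ω^d > 0`), the class of `i^{p-q}(-1)^{k(k-1)/2} (α ∧ ωʳ) ∧ ᾱ` is
`t [ω^d]` with `t = (i^{p-q}(-1)^{k(k-1)/2} ∫ α ∧ ᾱ ∧ ωʳ) / ∫ ω^d > 0` (integration descends to
cohomology, Stokes). [cite: VoisinHodgeI2002, §6.3.2 Thm. 6.32] [cite: Huybrechts2005, Prop. 3.3.15] -/
theorem hodgeRiemann_primitiveClass [ConnectedSpace M] {e} (hem : e.IsMultiplicative)
    (hω : isSmoothForm_kaehlerForm_of_isManifold_complex (E := E) (M := M))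
    (g : ContMDiffRiemannianMetric 𝓘(ℝ, E) ∞ E (fun x : M ↦ TangentSpace 𝓘(ℝ, E) x))
    (hg : g.toRiemannianMetric.IsKaehler) {d : ℕ} (hd : finrank ℂ E = d)
    (htop : Module.finrank ℂ (singularCohomology ℂ ℂ M (2 * d)) = 1)
    {p q k r : ℕ} (hkr : k + r = d) (h2 : (k + 2 * r) + k = 2 * d)
    {c : complexDeRhamCohomology E M k} (hc : c ∈ hodgePQ E M k p q) (hc0 : c ≠ 0)
    (hprim : lefschetzPow (ofRealClass M 2 (e M 2 (g.kaehlerClass hω hg))) (r + 1) k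
      (complexifyFun e k c) = 0) :
    ∃ t : ℝ, 0 < t ∧
      (Complex.I ^ ((p : ℤ) - q) * (-1) ^ (k * (k - 1) / 2)) •
          cupProduct h2 (lefschetzPow (ofRealClass M 2 (e M 2 (g.kaehlerClass hω hg))) r k
            (complexifyFun e k c)) (conjClass M k (complexifyFun e k c)) =
        (t : ℂ) • ofRealClass M (2 * d) (e M (2 * d)
          (deRhamCohomology.mk ⟨kaehlerFormPow g.toRiemannianMetric d,
            kaehlerFormPow_mem_closedSmoothForms hω g hg d⟩)) := by
  subst hd
  classical
  -- `p + q = k`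
  have hpq : p + q = k := by
    by_contra hne
    rw [hodgePQ_eq_bot_of_ne hne, Submodule.mem_bot] at hc
    exact hc0 hc
  subst hpq
  -- instances
  letI : RiemannianBundle (fun x : M ↦ TangentSpace 𝓘(ℝ, E) x) := ⟨g.toRiemannianMetric⟩
  haveI : IsContMDiffRiemannianBundle 𝓘(ℝ, E) ∞ E (fun x : M ↦ TangentSpace 𝓘(ℝ, E) x) :=
    ⟨g.inner, g.contMDiff, fun _ _ _ ↦ rfl⟩
  haveI : IsContinuousRiemannianBundle E (fun x : M ↦ TangentSpace 𝓘(ℝ, E) x) :=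
    ⟨g.inner, g.contMDiff.continuous, fun _ _ _ ↦ rfl⟩
  haveI : WedgeFacts 𝓘(ℝ, E) M ℝ :=
    wedgeFacts_of_assoc 𝓘(ℝ, E) M ℝ (ContinuousAlternatingMap.WedgeAssoc_holds ℝ E ℝ)
  haveI : WedgeFacts 𝓘(ℝ, E) M ℂ :=
    wedgeFacts_of_assoc 𝓘(ℝ, E) M ℂ (ContinuousAlternatingMap.WedgeAssoc_holds ℝ E ℂ)
  letI : MeasurableSpace E := borel E
  haveI : BorelSpace E := ⟨rfl⟩
  haveI : Fact (finrank ℝ E = 2 * finrank ℂ E) := ⟨finrank_real_of_complex E⟩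
  -- the complex orientation, normalised by `∫ ω^d > 0`
  obtain ⟨o₀, hcont, hpos⟩ := exists_orientation_integral_kaehlerFormPow_pos (M := M) g hg.1
  set o : (x : M) → Orientation ℝ (TangentSpace 𝓘(ℝ, E) x) (Fin (2 * finrank ℂ E)) := fun _ ↦ o₀
    with hodef
  have ho : IsSmoothForm (riemannianVolumeForm o) :=
    isSmoothForm_riemannianVolumeForm_of_isContinuousOrientation_holds o hcont
  -- degrees
  have h : (p + q) + ((p + q) + 2 * r) = 2 * finrank ℂ E := by omega
  -- the `∂̄`-harmonic representative of `c`
  have h11 : ∀ [CompactSpace M] [T2Space M] {k m : ℕ},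
      letI : RiemannianBundle (fun x : M ↦ TangentSpace 𝓘(ℝ, E) x) := ⟨g.toRiemannianMetric⟩
      existsUnique_isHarmonicForm_mk_eq (k := k) (m := m) 𝓘(ℝ, E) o := by
    intro _ _ k m
    exact existsUnique_isHarmonicForm_mk_eq_of_compact_of_isKaehler g o hg k m
  have hK : ∀ [IsManifold 𝓘(ℂ, E) ω M] {k m : ℕ},
      cHodgeLaplacian_eq_two_smul_dolbeaultLaplacian_of_isManifold_complex (k := k) (m := m) g o := by
    intro _ k m
    exact cHodgeLaplacian_eq_two_smul_dolbeaultLaplacian_of_isManifold_complex_of_t2Space g o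
  obtain ⟨α, ⟨hαH, hαc, hmk⟩, -⟩ :=
    existsUnique_isDolbeaultHarmonic_of_mem_hodgePQ_of g o h11 hK hg h hc ho
  have hαs : IsSmoothForm α := ((mem_cclosedSmoothForms_iff α).1 hαc).1
  have hα0 : α ≠ 0 := by
    rintro rfl
    apply hc0
    rw [← hmk]
    exact (complexDeRhamCohomology.mk E M (p + q)).map_zero
  -- the Lefschetz iterates of `u = (e ⊗ ℂ) c` are the classes of `α ∧ ωʲ`
  have hL : ∀ j, lefschetzPow (ofRealClass M 2 (e M 2 (g.kaehlerClass hω hg))) j (p + q)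
      (complexifyFun e (p + q) c) = complexifyFun e ((p + q) + 2 * j)
        (complexDeRhamCohomology.mk E M ((p + q) + 2 * j)
          ⟨α.wedge (kaehlerFormPow g.toRiemannianMetric j).ofReal,
            wedge_kaehlerFormPow_ofReal_mem_cclosedSmoothForms hω g hg hαc j⟩) := fun j ↦ by
    rw [← hmk]
    exact lefschetzPow_complexifyFun_mk hem hω g hg ⟨α, hαc⟩ j
  -- primitivity AS A FORM
  have hprimF : α.wedge (kaehlerFormPow g.toRiemannianMetric (r + 1)).ofReal = 0 := by
    have h0 : complexDeRhamCohomology.mk E M ((p + q) + 2 * (r + 1))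
        ⟨α.wedge (kaehlerFormPow g.toRiemannianMetric (r + 1)).ofReal,
          wedge_kaehlerFormPow_ofReal_mem_cclosedSmoothForms hω g hg hαc (r + 1)⟩ = 0 := by
      apply (e.complexifyEquiv M ((p + q) + 2 * (r + 1))).injective
      rw [complexifyEquiv_apply, ← hL (r + 1), hprim, LinearEquiv.map_zero]
    by_cases hdeg : (p + q) + 2 * (r + 1) ≤ 2 * finrank ℂ E
    · obtain ⟨m', hm'⟩ : ∃ m', ((p + q) + 2 * (r + 1)) + m' = 2 * finrank ℂ E :=
        ⟨_, Nat.add_sub_cancel' hdeg⟩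
      exact wedge_kaehlerFormPow_ofReal_eq_zero_of_mk_eq_zero g o hg h hm' _ ho hαH h0
    · exact mform_eq_zero_of_finrank_real_lt _ (by rw [finrank_real_of_complex]; omega)
  -- hodge.S15 for `α`
  have hvol : 0 < MForm.integral o
      ((kaehlerFormPow g.toRiemannianMetric (finrank ℂ E)).castDeg rfl) := by
    rw [MForm.castDeg_rfl]; exact hpos
  obtain ⟨hre, him⟩ := hodge_riemann_bilinear_holds o g hg hkr rfl h ho hvol hαH hprimF hα0
  -- notation
  set C : ℂ := Complex.I ^ ((p : ℤ) - q) * (-1) ^ ((p + q) * ((p + q) - 1) / 2) with hC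
  set F : MForm 𝓘(ℝ, E) M ℂ (2 * finrank ℂ E) :=
    (α.wedge (α.conj.wedge (kaehlerFormPow g.toRiemannianMetric r).ofReal)).castDeg h with hF
  set Ω : MForm 𝓘(ℝ, E) M ℝ (2 * finrank ℂ E) := kaehlerFormPow g.toRiemannianMetric (finrank ℂ E)
    with hΩ
  have hΩc : Ω ∈ closedSmoothForms 𝓘(ℝ, E) M ℝ (2 * finrank ℂ E) :=
    kaehlerFormPow_mem_closedSmoothForms hω g hg (finrank ℂ E)
  have hΩc' : Ω.ofReal ∈ cclosedSmoothForms E M (2 * finrank ℂ E) := ofReal_mem_cclosedSmoothForms hΩc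
  -- `C ∫ F` is the positive real `ρ`
  set ρ : ℝ := (C * cintegral o F).re with hρ
  have hCF : C * cintegral o F = (ρ : ℂ) := Complex.ext (by simp [hρ]) (by simpa using him)
  refine ⟨ρ / MForm.integral o Ω, div_pos hre hpos, ?_⟩
  -- the left-hand side as the class of `C • ((α ∧ ωʳ) ∧ ᾱ)`
  have hwc : (α.wedge (kaehlerFormPow g.toRiemannianMetric r).ofReal).wedge α.conj ∈
      cclosedSmoothForms E M ((p + q) + 2 * r + (p + q)) :=
    wedge_mem_cclosedSmoothForms (wedge_kaehlerFormPow_ofReal_mem_cclosedSmoothForms hω g hg hαc r)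
      (conj_mem_cclosedSmoothForms_holds hαc)
  set F' : MForm 𝓘(ℝ, E) M ℂ (2 * finrank ℂ E) :=
    ((α.wedge (kaehlerFormPow g.toRiemannianMetric r).ofReal).wedge α.conj).castDeg h2 with hF'
  have hF'c : F' ∈ cclosedSmoothForms E M (2 * finrank ℂ E) := castDeg_mem_cclosedSmoothForms h2 hwc
  have hconj : conjClass M (p + q) (complexifyFun e (p + q) c) =
      complexifyFun e (p + q) (complexDeRhamCohomology.mk E M (p + q)
        ⟨α.conj, conj_mem_cclosedSmoothForms_holds hαc⟩) := by
    rw [← hmk, conjClass_complexifyFun, complexDeRhamCohomology.conj_mk]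
  have hlhs : cupProduct h2 (lefschetzPow (ofRealClass M 2 (e M 2 (g.kaehlerClass hω hg))) r (p + q)
        (complexifyFun e (p + q) c)) (conjClass M (p + q) (complexifyFun e (p + q) c)) =
      complexifyFun e (2 * finrank ℂ E) (complexDeRhamCohomology.mk E M _ ⟨F', hF'c⟩) := by
    rw [hL r, hconj, cupProduct_complexifyFun_mk hem h2]
  -- the right-hand side as the class of `Ω ⊗ 1`
  have hrhs : ofRealClass M (2 * finrank ℂ E) (e M (2 * finrank ℂ E) (deRhamCohomology.mk ⟨Ω, hΩc⟩)) =
      complexifyFun e (2 * finrank ℂ E) (complexDeRhamCohomology.mk E M _ ⟨Ω.ofReal, hΩc'⟩) := by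
    rw [← complexifyFun_ofReal]
    rfl
  -- `H^{2d}_dR(M; ℂ)` is a line spanned by `[Ω ⊗ 1]`
  have hΩ0 : complexDeRhamCohomology.mk E M _ ⟨Ω.ofReal, hΩc'⟩ ≠ 0 := by
    have hne := kaehlerFormPow_deRhamCohomology_mk_ne_zero g hg (k := finrank ℂ E) le_rfl hΩc
    intro h0
    apply hne
    apply complexDeRhamCohomology.ofReal_injective
    rw [complexDeRhamCohomology.ofReal_mk, LinearMap.map_zero]
    exact h0
  have hdim : Module.finrank ℂ (complexDeRhamCohomology E M (2 * finrank ℂ E)) = 1 := by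
    rw [← htop]
    exact (e.complexifyEquiv M (2 * finrank ℂ E)).finrank_eq
  obtain ⟨s, hs⟩ := (finrank_eq_one_iff_of_nonzero' _ hΩ0).1 hdim
    (complexDeRhamCohomology.mk E M _ ⟨C • F', (cclosedSmoothForms E M _).smul_mem C hF'c⟩)
  -- integrate: `C ∫ F' = s ∫ Ω`
  have hsF : (s • (⟨Ω.ofReal, hΩc'⟩ : cclosedSmoothForms E M (2 * finrank ℂ E))) =
      ⟨s • Ω.ofReal, (cclosedSmoothForms E M _).smul_mem s hΩc'⟩ := rfl
  have hint : C * cintegral o F' = s * MForm.integral o Ω := by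
    have h1 := cintegral_eq_of_mk_eq o hcont ((cclosedSmoothForms E M _).smul_mem C hF'c)
      ((cclosedSmoothForms E M _).smul_mem s hΩc') (by rw [← hs, ← hsF, LinearMap.map_smul])
    have hsF' : IsSmoothForm F' :=
      isSmoothForm_castDeg h2 (isSmoothForm_wedge (isSmoothForm_wedge hαs
        (isSmoothForm_kaehlerFormPow hω g r).ofReal) (isSmoothForm_conj hαs))
    rw [cintegral_smul o hcont C hsF', cintegral_smul o hcont s
      (isSmoothForm_kaehlerFormPow hω g (finrank ℂ E)).ofReal, cintegral_ofReal] at h1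
    exact h1
  -- `F' = F` (associativity and graded commutativity, `ωʳ` of even degree)
  have hFF' : F' = F := by
    rw [hF', hF, MForm.wedge_assoc,
      MForm.wedge_comm α.conj (kaehlerFormPow g.toRiemannianMetric r).ofReal,
      Even.neg_one_pow ⟨(p + q) * r, by ring⟩, one_smul, MForm.wedge_castDeg, MForm.castDeg_castDeg,
      MForm.castDeg_castDeg]
  -- hence `s = ρ / ∫ Ω`
  have hs' : s = ((ρ / MForm.integral o Ω : ℝ) : ℂ) := by
    rw [hFF', hCF] at hint
    have hI : (MForm.integral o Ω : ℂ) ≠ 0 := by exact_mod_cast hpos.ne'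
    rw [Complex.ofReal_div, eq_div_iff hI, hint]
  -- assemble
  rw [hlhs, hrhs, ← complexifyFun_smul, ← complexifyFun_smul, ← hs', hs, ← LinearMap.map_smul]
  rfl

end Classes

end Literature.AlgebraicGeometry.HodgeTheory
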